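import Summits.BirchSwinnertonDyer.Rank1Residual.O5.NoLocalThreeTorsionIIIstar
import HarnessLib

/-!
# LAW L-t3, valued-field layer: the `b₈` / `b₂` valuations on Tate's `IV*` (`v(Δ) = 10`) and `II*`
# (`v(Δ) = 12`) shapes at a uniformiser `3`, and two small `ℤᵐ⁰` facts (route `CyclotomicUntwist`)

Cell `pub/bsd-wall` (D-0145 line `route-BirchSwinnertonDyer-CyclotomicUntwist`), seat `bsd-line-cycu-p2`
(prover seat 2/3, gen 3), helper toward K1 `PSRankOneLowerHalfAtThree` (stmt-BirchSwinnertonDyer-21580) and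
K2 `PSRankOneUpperHalfAtThree` (stmt-21581). THEOREMS ONLY (no definition, no named fact, no `sorry`);
pure valued-field algebra, no curve is mentioned; BSD is not proved by this file and no crux is. Consumed
by the sequel `CyclotomicUntwistPSLocalThreeTorsionStar.lean` (Kodaira `IV*`/`II*` at `3` ⟹ `W(ℚ₃)[3] = 0`),
in the style of the O5 file `O5/NonSplitAtThreeLocal.lean` (`map_b₈_of_shapeIII`), whose lemma
`map_three` is used by name.

For a `ℤᵐ⁰`-valuation `w` on a field `F` with `3 = ϖ`, `w ϖ = exp (−1)`, and `b₂, b₄, b₆, b₈ ∈ F` with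
`4b₈ = b₂b₆ − b₄²`, `Δ := −b₂²b₈ − 8b₄³ − 27b₆² + 9b₂b₄b₆` (Silverman *AEC* III.1):
* `map_b₈_of_shapeIVstar_ten`: `w b₂ ≤ e⁻²`, `w b₄ ≤ e⁻³`, `w b₆ = e⁻⁴`, `w Δ = e⁻¹⁰` ⟹ `w b₈ = e⁻⁶`
  (first `w b₄ ≤ e⁻⁴`, else `8b₄³` dominates `Δ` strictly at `e⁻⁹`; then `w b₈ ≤ e⁻⁶`, and `w b₈ < e⁻⁶`
  would put every term of `Δ` at most `e⁻¹¹`);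
* `map_b₂_b₈_of_shapeIIstar_twelve`: `w b₂ ≤ e⁻²`, `w b₄ ≤ e⁻⁴`, `w b₆ = e⁻⁵`, `w Δ = e⁻¹²` ⟹ `w b₂ ≤ e⁻³`
  and `w b₈ ≤ e⁻⁸` (if `w b₂ = e⁻²` then `w b₈ = e⁻⁷` and `b₂²b₈` dominates `Δ` at `e⁻¹¹`);
* `map_lt_one_of_root_of_lt_one`: a monic quartic with coefficients of valuation `< 1` has all its roots
  of valuation `< 1`; `sq_ne_exp_of_odd`: `a² ≠ exp n` for `n` odd; `map_consts`: `w 4 = w 8 = 1`,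
  `w 2 ≤ 1`, `w 27 ≤ e⁻³`, `w 9 ≤ e⁻²`.

References: J. H. Silverman, *Advanced Topics in the Arithmetic of Elliptic Curves* (1994), IV.9.4 Steps 8,
10 (normal forms of types IV*, II*) [SilvermanATAEC1994]; *The Arithmetic of Elliptic Curves* (2009),
III.1 [SilvermanAEC2009].
-/


set_option autoImplicit false
-- single-conjunct summit: `Summit.BirchSwinnertonDyer.BirchSwinnertonDyer.…` repeats the name by design
set_option linter.dupNamespace false

noncomputable section

open scoped Classical

open Polynomial WeierstrassCurve IsDedekindDomain IsDedekindDomain.HeightOneSpectrum WithZero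
  Rat.HeightOneSpectrum Literature.NumberTheory.EllipticCurves
  Literature.NumberTheory.EllipticCurves.Rank1Residual Literature.NumberTheory.DiophantineGeometry
  Summit.BirchSwinnertonDyer.Rank1Residual.Additive Summit.BirchSwinnertonDyer.Rank1Residual.O5
  Summit.BirchSwinnertonDyer.Rank1Residual.O5.NonSplitAtThree

open Summit.BirchSwinnertonDyer.Rank1Residual.Additive.ThreeAdicLift (le_exp_sub_one_of_lt_exp)

namespace Summit.BirchSwinnertonDyer.BirchSwinnertonDyer.Theorems.PSLocalThreeTorsion

/-! ## §1 Valued-field algebra on the `IV*` and `II*` shapes -/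

section Valued

variable {F : Type*} [Field F] (w : Valuation F ℤᵐ⁰) {ϖ : F}

omit w in
/-- **Odd exponents are not squares in `ℤᵐ⁰`**: `a² ≠ exp n` for `n` odd. [folklore] -/
theorem sq_ne_exp_of_odd (a : ℤᵐ⁰) {n : ℤ} (hn : Odd n) : a ^ 2 ≠ exp n := by
  intro h
  rcases eq_or_ne a 0 with h0 | h0
  · rw [h0, zero_pow two_ne_zero] at h
    exact exp_ne_zero h.symm
  · rw [← exp_log h0, ← exp_nsmul, exp_inj, nsmul_eq_mul] at h
    push_cast at h
    obtain ⟨k, hk⟩ := hn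
    omega

/-- The small constants at the uniformiser `3`: `w 4 = 1`, `w 8 = 1`, `w 2 ≤ 1`, `w 27 ≤ e⁻³`,
`w 9 ≤ e⁻²`. [folklore] -/
theorem map_consts (h3 : (3 : F) = ϖ) (hϖ : w ϖ = exp (-1 : ℤ)) :
    w 4 = 1 ∧ w 8 = 1 ∧ w 2 ≤ 1 ∧ w 27 ≤ exp (-3 : ℤ) ∧ w 9 ≤ exp (-2 : ℤ) := by
  have w3 := map_three w h3 hϖ
  have hlt1 : exp (-1 : ℤ) < (1 : ℤᵐ⁰) := by rw [← exp_zero, exp_lt_exp]; norm_num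
  have w9 : w 9 ≤ exp (-2 : ℤ) := by
    rw [show (9 : F) = 3 * 3 by norm_num, map_mul, w3, ← exp_add]
    exact le_of_eq (by norm_num)
  refine ⟨?_, ?_, ?_, ?_, w9⟩
  · rw [show (4 : F) = 1 + 3 by norm_num]
    exact Valuation.map_one_add_of_lt w (by rw [w3]; exact hlt1)
  · rw [show (8 : F) = -1 + 9 by norm_num]
    rw [Valuation.map_add_eq_of_lt_left w (by
      rw [Valuation.map_neg, map_one]
      exact lt_of_le_of_lt w9 (by rw [← exp_zero, exp_lt_exp]; norm_num)), Valuation.map_neg, map_one]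
  · rw [show (2 : F) = 3 - 1 by norm_num]
    exact Valuation.map_sub_le w (by rw [w3]; exact hlt1.le) (by rw [map_one])
  · rw [show (27 : F) = 3 * 3 * 3 by norm_num, map_mul, map_mul, w3, ← exp_add, ← exp_add]
    exact le_of_eq (by norm_num)

/-- **Type-`IV*` shape with `w Δ = exp (−10)` ⟹ `w b₈ = exp (−6)`.** On `w b₂ ≤ e⁻²`, `w b₄ ≤ e⁻³`,
`w b₆ = e⁻⁴` with `4b₈ = b₂b₆ − b₄²` and `w Δ = e⁻¹⁰` (`Δ = −b₂²b₈ − 8b₄³ − 27b₆² + 9b₂b₄b₆`): first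
`w b₄ ≤ e⁻⁴` (otherwise `8b₄³` has valuation `e⁻⁹` and dominates strictly), then `w b₈ ≤ e⁻⁶`, and
`w b₈ < e⁻⁶` would put every term of `Δ` at most `e⁻¹¹`. [cite: SilvermanATAEC1994, IV.9.4 Step 8 (normal form of type IV*)] -/
theorem map_b₈_of_shapeIVstar_ten (h3 : (3 : F) = ϖ) (hϖ : w ϖ = exp (-1 : ℤ)) {b₂ b₄ b₆ b₈ : F}
    (hb₂ : w b₂ ≤ exp (-2 : ℤ)) (hb₄ : w b₄ ≤ exp (-3 : ℤ)) (hb₆ : w b₆ = exp (-4 : ℤ))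
    (hrel : 4 * b₈ = b₂ * b₆ - b₄ ^ 2)
    (hΔ : w (-b₂ ^ 2 * b₈ - 8 * b₄ ^ 3 - 27 * b₆ ^ 2 + 9 * b₂ * b₄ * b₆) = exp (-10 : ℤ)) :
    w b₈ = exp (-6 : ℤ) := by
  obtain ⟨w4, w8, -, w27, w9⟩ := map_consts w h3 hϖ
  have hT3 : w (27 * b₆ ^ 2) ≤ exp (-11 : ℤ) := by
    rw [map_mul, map_pow, hb₆]
    calc w 27 * exp (-4 : ℤ) ^ 2 ≤ exp (-3 : ℤ) * exp (-4 : ℤ) ^ 2 := mul_le_mul' w27 le_rfl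
      _ = exp (-11 : ℤ) := by rw [← exp_nsmul, ← exp_add]; norm_num
  have hT4 : w (9 * b₂ * b₄ * b₆) ≤ exp (-11 : ℤ) := by
    rw [map_mul, map_mul, map_mul, hb₆]
    calc w 9 * w b₂ * w b₄ * exp (-4 : ℤ) ≤ exp (-2 : ℤ) * exp (-2 : ℤ) * exp (-3 : ℤ) * exp (-4 : ℤ) :=
          mul_le_mul' (mul_le_mul' (mul_le_mul' w9 hb₂) hb₄) le_rfl
      _ = exp (-11 : ℤ) := by rw [← exp_add, ← exp_add, ← exp_add]; norm_num
  -- Step 1: `w b₄ ≤ e⁻⁴`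
  have hb₄' : w b₄ ≤ exp (-4 : ℤ) := by
    rcases hb₄.eq_or_lt with h4eq | h4lt
    · exfalso
      have hb₈' : w b₈ ≤ exp (-6 : ℤ) := by
        have h : w (4 * b₈) ≤ exp (-6 : ℤ) := by
          rw [hrel]
          refine Valuation.map_sub_le w ?_ ?_
          · calc w (b₂ * b₆) ≤ exp (-2 + -4 : ℤ) := map_mul_le_exp_add w hb₂ hb₆.le
              _ = exp (-6 : ℤ) := by norm_num
          · rw [map_pow, h4eq, ← exp_nsmul]; norm_num
        rwa [map_mul, w4, one_mul] at h
      have hT1 : w (-b₂ ^ 2 * b₈) ≤ exp (-10 : ℤ) := by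
        rw [Valuation.map_mul, Valuation.map_neg, map_pow]
        calc w b₂ ^ 2 * w b₈ ≤ exp (-2 : ℤ) ^ 2 * exp (-6 : ℤ) :=
              mul_le_mul' (pow_le_pow_left' hb₂ 2) hb₈'
          _ = exp (-10 : ℤ) := by rw [← exp_nsmul, ← exp_add]; norm_num
      have hT2 : w (8 * b₄ ^ 3) = exp (-9 : ℤ) := by
        rw [map_mul, map_pow, w8, one_mul, h4eq, ← exp_nsmul]; norm_num
      have l1 : w (-b₂ ^ 2 * b₈) < w (8 * b₄ ^ 3) := by
        rw [hT2]; exact lt_of_le_of_lt hT1 (by rw [exp_lt_exp]; norm_num)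
      have e1 : w (-b₂ ^ 2 * b₈ - 8 * b₄ ^ 3) = exp (-9 : ℤ) := by
        rw [Valuation.map_sub_eq_of_lt_right w l1, hT2]
      have l2 : w (27 * b₆ ^ 2) < w (-b₂ ^ 2 * b₈ - 8 * b₄ ^ 3) := by
        rw [e1]; exact lt_of_le_of_lt hT3 (by rw [exp_lt_exp]; norm_num)
      have e2 : w (-b₂ ^ 2 * b₈ - 8 * b₄ ^ 3 - 27 * b₆ ^ 2) = exp (-9 : ℤ) := by
        rw [Valuation.map_sub_eq_of_lt_left w l2, e1]
      have l3 : w (9 * b₂ * b₄ * b₆) < w (-b₂ ^ 2 * b₈ - 8 * b₄ ^ 3 - 27 * b₆ ^ 2) := by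
        rw [e2]; exact lt_of_le_of_lt hT4 (by rw [exp_lt_exp]; norm_num)
      have e3 : w (-b₂ ^ 2 * b₈ - 8 * b₄ ^ 3 - 27 * b₆ ^ 2 + 9 * b₂ * b₄ * b₆) = exp (-9 : ℤ) := by
        rw [Valuation.map_add_eq_of_lt_left w l3, e2]
      rw [hΔ, exp_inj] at e3
      norm_num at e3
    · have := le_exp_sub_one_of_lt_exp h4lt
      rwa [show (-3 : ℤ) - 1 = -4 by norm_num] at this
  -- Step 2: `w b₈ ≤ e⁻⁶`
  have hb₈le : w b₈ ≤ exp (-6 : ℤ) := by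
    have h : w (4 * b₈) ≤ exp (-6 : ℤ) := by
      rw [hrel]
      refine Valuation.map_sub_le w ?_ ?_
      · calc w (b₂ * b₆) ≤ exp (-2 + -4 : ℤ) := map_mul_le_exp_add w hb₂ hb₆.le
          _ = exp (-6 : ℤ) := by norm_num
      · rw [map_pow]
        calc w b₄ ^ 2 ≤ exp (-4 : ℤ) ^ 2 := pow_le_pow_left' hb₄' 2
          _ ≤ exp (-6 : ℤ) := by rw [← exp_nsmul, exp_le_exp]; norm_num
    rwa [map_mul, w4, one_mul] at h
  -- Step 3: `w b₈ < e⁻⁶` is impossible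
  rcases hb₈le.eq_or_lt with h8eq | h8lt
  · exact h8eq
  · exfalso
    have hb₈' : w b₈ ≤ exp (-7 : ℤ) := by
      have := le_exp_sub_one_of_lt_exp h8lt
      rwa [show (-6 : ℤ) - 1 = -7 by norm_num] at this
    have hT1 : w (-b₂ ^ 2 * b₈) ≤ exp (-11 : ℤ) := by
      rw [Valuation.map_mul, Valuation.map_neg, map_pow]
      calc w b₂ ^ 2 * w b₈ ≤ exp (-2 : ℤ) ^ 2 * exp (-7 : ℤ) :=
            mul_le_mul' (pow_le_pow_left' hb₂ 2) hb₈'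
        _ = exp (-11 : ℤ) := by rw [← exp_nsmul, ← exp_add]; norm_num
    have hT2 : w (8 * b₄ ^ 3) ≤ exp (-11 : ℤ) := by
      rw [map_mul, map_pow, w8, one_mul]
      calc w b₄ ^ 3 ≤ exp (-4 : ℤ) ^ 3 := pow_le_pow_left' hb₄' 3
        _ ≤ exp (-11 : ℤ) := by rw [← exp_nsmul, exp_le_exp]; norm_num
    have hle : w (-b₂ ^ 2 * b₈ - 8 * b₄ ^ 3 - 27 * b₆ ^ 2 + 9 * b₂ * b₄ * b₆) ≤ exp (-11 : ℤ) :=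
      Valuation.map_add_le w (Valuation.map_sub_le w (Valuation.map_sub_le w hT1 hT2) hT3) hT4
    rw [hΔ, exp_le_exp] at hle
    norm_num at hle

/-- **Type-`II*` shape with `w Δ = exp (−12)` ⟹ `w b₂ ≤ exp (−3)` and `w b₈ ≤ exp (−8)`.** On
`w b₂ ≤ e⁻²`, `w b₄ ≤ e⁻⁴`, `w b₆ = e⁻⁵`, `4b₈ = b₂b₆ − b₄²`: if `w b₂ = e⁻²` then `w b₈ = e⁻⁷` and
`b₂²b₈` dominates `Δ` strictly at `e⁻¹¹`. [cite: SilvermanATAEC1994, IV.9.4 Step 10 (normal form of type II*)] -/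
theorem map_b₂_b₈_of_shapeIIstar_twelve (h3 : (3 : F) = ϖ) (hϖ : w ϖ = exp (-1 : ℤ))
    {b₂ b₄ b₆ b₈ : F} (hb₂ : w b₂ ≤ exp (-2 : ℤ)) (hb₄ : w b₄ ≤ exp (-4 : ℤ))
    (hb₆ : w b₆ = exp (-5 : ℤ)) (hrel : 4 * b₈ = b₂ * b₆ - b₄ ^ 2)
    (hΔ : w (-b₂ ^ 2 * b₈ - 8 * b₄ ^ 3 - 27 * b₆ ^ 2 + 9 * b₂ * b₄ * b₆) = exp (-12 : ℤ)) :
    w b₂ ≤ exp (-3 : ℤ) ∧ w b₈ ≤ exp (-8 : ℤ) := by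
  obtain ⟨w4, w8, -, w27, w9⟩ := map_consts w h3 hϖ
  have hsq : w (b₄ ^ 2) ≤ exp (-8 : ℤ) := by
    rw [map_pow]
    calc w b₄ ^ 2 ≤ exp (-4 : ℤ) ^ 2 := pow_le_pow_left' hb₄ 2
      _ = exp (-8 : ℤ) := by rw [← exp_nsmul]; norm_num
  have hb₂' : w b₂ ≤ exp (-3 : ℤ) := by
    rcases hb₂.eq_or_lt with h2eq | h2lt
    · exfalso
      have h26 : w (b₂ * b₆) = exp (-7 : ℤ) := by rw [map_mul, h2eq, hb₆, ← exp_add]; norm_num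
      have hb₈' : w b₈ = exp (-7 : ℤ) := by
        have l0 : w (b₄ ^ 2) < w (b₂ * b₆) := by
          rw [h26]; exact lt_of_le_of_lt hsq (by rw [exp_lt_exp]; norm_num)
        have h : w (4 * b₈) = exp (-7 : ℤ) := by
          rw [hrel, Valuation.map_sub_eq_of_lt_left w l0, h26]
        rwa [map_mul, w4, one_mul] at h
      have hT1 : w (-b₂ ^ 2 * b₈) = exp (-11 : ℤ) := by
        rw [Valuation.map_mul, Valuation.map_neg, map_pow, h2eq, hb₈', ← exp_nsmul, ← exp_add]
        norm_num
      have hT2 : w (8 * b₄ ^ 3) ≤ exp (-12 : ℤ) := by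
        rw [map_mul, map_pow, w8, one_mul]
        calc w b₄ ^ 3 ≤ exp (-4 : ℤ) ^ 3 := pow_le_pow_left' hb₄ 3
          _ = exp (-12 : ℤ) := by rw [← exp_nsmul]; norm_num
      have hT3 : w (27 * b₆ ^ 2) ≤ exp (-13 : ℤ) := by
        rw [map_mul, map_pow, hb₆]
        calc w 27 * exp (-5 : ℤ) ^ 2 ≤ exp (-3 : ℤ) * exp (-5 : ℤ) ^ 2 := mul_le_mul' w27 le_rfl
          _ = exp (-13 : ℤ) := by rw [← exp_nsmul, ← exp_add]; norm_num
      have hT4 : w (9 * b₂ * b₄ * b₆) ≤ exp (-13 : ℤ) := by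
        rw [map_mul, map_mul, map_mul, hb₆]
        calc w 9 * w b₂ * w b₄ * exp (-5 : ℤ) ≤
            exp (-2 : ℤ) * exp (-2 : ℤ) * exp (-4 : ℤ) * exp (-5 : ℤ) :=
              mul_le_mul' (mul_le_mul' (mul_le_mul' w9 hb₂) hb₄) le_rfl
          _ = exp (-13 : ℤ) := by rw [← exp_add, ← exp_add, ← exp_add]; norm_num
      have l1 : w (8 * b₄ ^ 3) < w (-b₂ ^ 2 * b₈) := by
        rw [hT1]; exact lt_of_le_of_lt hT2 (by rw [exp_lt_exp]; norm_num)
      have e1 : w (-b₂ ^ 2 * b₈ - 8 * b₄ ^ 3) = exp (-11 : ℤ) := by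
        rw [Valuation.map_sub_eq_of_lt_left w l1, hT1]
      have l2 : w (27 * b₆ ^ 2) < w (-b₂ ^ 2 * b₈ - 8 * b₄ ^ 3) := by
        rw [e1]; exact lt_of_le_of_lt hT3 (by rw [exp_lt_exp]; norm_num)
      have e2 : w (-b₂ ^ 2 * b₈ - 8 * b₄ ^ 3 - 27 * b₆ ^ 2) = exp (-11 : ℤ) := by
        rw [Valuation.map_sub_eq_of_lt_left w l2, e1]
      have l3 : w (9 * b₂ * b₄ * b₆) < w (-b₂ ^ 2 * b₈ - 8 * b₄ ^ 3 - 27 * b₆ ^ 2) := by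
        rw [e2]; exact lt_of_le_of_lt hT4 (by rw [exp_lt_exp]; norm_num)
      have e3 : w (-b₂ ^ 2 * b₈ - 8 * b₄ ^ 3 - 27 * b₆ ^ 2 + 9 * b₂ * b₄ * b₆) = exp (-11 : ℤ) := by
        rw [Valuation.map_add_eq_of_lt_left w l3, e2]
      rw [hΔ, exp_inj] at e3
      norm_num at e3
    · have := le_exp_sub_one_of_lt_exp h2lt
      rwa [show (-2 : ℤ) - 1 = -3 by norm_num] at this
  refine ⟨hb₂', ?_⟩
  have h : w (4 * b₈) ≤ exp (-8 : ℤ) := by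
    rw [hrel]
    refine Valuation.map_sub_le w ?_ hsq
    calc w (b₂ * b₆) ≤ exp (-3 + -5 : ℤ) := map_mul_le_exp_add w hb₂' hb₆.le
      _ = exp (-8 : ℤ) := by norm_num
  rwa [map_mul, w4, one_mul] at h

/-- **A monic quartic with coefficients of valuation `< 1` has all its roots of valuation `< 1`.**
[folklore] -/
theorem map_lt_one_of_root_of_lt_one {c₃ c₂ c₁ c₀ r : F} (h₃ : w c₃ < 1) (h₂ : w c₂ < 1)
    (h₁ : w c₁ < 1) (h₀ : w c₀ < 1) (hr : r ^ 4 + c₃ * r ^ 3 + c₂ * r ^ 2 + c₁ * r + c₀ = 0) :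
    w r < 1 := by
  by_contra hge
  push Not at hge
  have hr0 : w r ≠ 0 := fun h0 ↦ by rw [h0] at hge; exact not_lt_of_ge hge zero_lt_one
  have hpow : ∀ {i j : ℕ}, i ≤ j → w r ^ i ≤ w r ^ j := fun hij ↦ pow_le_pow_right' hge hij
  have h4 : w (r ^ 4) = w r ^ 4 := map_pow _ _ _
  have hdom : ∀ {c : F} (i : ℕ), w c < 1 → i ≤ 4 → w (c * r ^ i) < w (r ^ 4) := by
    intro c i hc hi
    rw [map_mul, map_pow, h4]
    calc w c * w r ^ i < 1 * w r ^ i := mul_lt_mul_of_pos_right hc (pow_pos (zero_lt_iff.mpr hr0) i)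
      _ = w r ^ i := one_mul _
      _ ≤ w r ^ 4 := hpow hi
  have s1 : w (r ^ 4 + c₃ * r ^ 3) = w (r ^ 4) :=
    Valuation.map_add_eq_of_lt_left w (hdom 3 h₃ (by norm_num))
  have l2 : w (c₂ * r ^ 2) < w (r ^ 4 + c₃ * r ^ 3) := by rw [s1]; exact hdom 2 h₂ (by norm_num)
  have s2 : w (r ^ 4 + c₃ * r ^ 3 + c₂ * r ^ 2) = w (r ^ 4) := by
    rw [Valuation.map_add_eq_of_lt_left w l2, s1]
  have l3 : w (c₁ * r) < w (r ^ 4 + c₃ * r ^ 3 + c₂ * r ^ 2) := by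
    have h := hdom 1 h₁ (by norm_num)
    rw [pow_one] at h
    rw [s2]; exact h
  have s3 : w (r ^ 4 + c₃ * r ^ 3 + c₂ * r ^ 2 + c₁ * r) = w (r ^ 4) := by
    rw [Valuation.map_add_eq_of_lt_left w l3, s2]
  have l4 : w c₀ < w (r ^ 4 + c₃ * r ^ 3 + c₂ * r ^ 2 + c₁ * r) := by
    have h := hdom 0 h₀ (by norm_num)
    rw [pow_zero, mul_one] at h
    rw [s3]; exact h
  have s4 : w (r ^ 4 + c₃ * r ^ 3 + c₂ * r ^ 2 + c₁ * r + c₀) = w (r ^ 4) := by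
    rw [Valuation.map_add_eq_of_lt_left w l4, s3]
  rw [hr, map_zero, h4] at s4
  exact pow_ne_zero 4 hr0 s4.symm

end Valued


end Summit.BirchSwinnertonDyer.BirchSwinnertonDyer.Theorems.PSLocalThreeTorsion

end
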